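import Literature.MathematicalPhysics.QuantumManyBody.PeriodicBoseGasJastrow
import Literature.MathematicalPhysics.QuantumManyBody.PeriodicBoseGasFourier
import Mathlib.MeasureTheory.Function.Floor
import HarnessLib

/-!
# Many-body kernel expansions of the log-amplitude of a periodic Bose wave function

Topic `Literature/MathematicalPhysics/QuantumManyBody` (definition item `defn-ManyBodyKernelExpansion`,
companion of `PeriodicBoseGas.lean` and `PeriodicBoseGasJastrow.lean`; wanted by route BECGhostPlasma of
`Summits/AtomisticToContinuum/BoseEinsteinCondensation`, cruxes RiccatiClusterFixedPoint and
KernelClassScreening).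

For `N` bosons on the torus `(ℝ³/Lℤ³)` a positive, Bose-symmetric, translation-invariant, periodic wave
function `Ψ` is written as `Ψ = e^{-S}` and its log-amplitude `S` is expanded over the subsets of
particles,

`S(X) = -log Ψ(X) = ∑_{k=2}^{N} ∑_{A ⊆ {1,…,N}, |A| = k} u_k(X_A) + const`,

with `k`-body kernels `u_k : (ℝ³)^k → ℝ` that are symmetric, translation invariant and `Lℤ³`-periodic
in each variable. This is the continuum analogue of the expansion `ψ_Λ(σ) = exp(-½ ∑_{A ⊂ Λ} J_Λ(A) σ(A))`
of the (Perron–Frobenius positive) ground state of a quantum lattice system in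
[KirkwoodThomas1983, §II, (2.1)–(2.3)], whose coefficients are controlled in the `ℓ¹`-norm over subsets
`‖χ‖ = ∑_A |χ(A)|` based at a site [KirkwoodThomas1983, (2.3)–(2.4), Thm. 2.1]; the Jastrow (Bijl–Dingle–
Jastrow) state `∏_{i<j} f(xᵢ - xⱼ)` of `PeriodicBoseGasJastrow.lean` is the case `u₂ = -log f`, `u_k = 0`
for `k ≥ 3`.

## Contents

* `subConfig X A` — the configuration `X_A` of the particles of `A ⊆ Fin N` in increasing order.
* `ManyBodyKernelExpansion N L` — a family of kernels `u_k : Config k → ℝ`, `k ∈ ℕ`, measurable,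
  symmetric, translation invariant and periodic in each variable (orders `k < 2` and `k > N` are carried
  but never evaluated); it is an additive commutative monoid with an `ℝ`-action (kernelwise).
* `logAmplitude u X = ∑_{k=2}^{N} ∑_{|A| = k} u_{|A|}(X_A)` (the double `Finset` sum) and
  `Represents Ψ u`: `‖Ψ(X)‖ = exp(-(logAmplitude u X + c))` for a constant `c` wherever `Ψ(X) ≠ 0`.
* `kernelNorm u m = sup_{x} ∫_{cell^m} |u_{m+1}(x, Y)| dY` (the `sup–L¹` kernel norm of
  [BrydgesFederbush1980, Lemma 9.6 (9.411), App. 1 (A1.9)]) and the **polymer norm**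
  `polymerNorm w u = ∑_{k=3}^{N} w^{-(k-2)} sup_{x₁} ∫_{cell^{k-1}} |u_k(x₁, x₂, …, x_k)| dx₂⋯dx_k ∈ [0,∞]`
  (weight `w ∈ (0,1)`, intended `w = √(ρa³)`), written as a sum over `j = k - 2 ∈ [1, N-2]`.
* `IsReattoChesterTail L C T` — the tail class `|T̂(p)| ≤ C/|p|`, `p ∈ (2π/L)ℤ³ ∖ {0}`, for the
  unnormalised torus Fourier coefficients `T̂(p) = ∫_{[0,L)³} e^{-ip·x} T(x) dx` (the `1/r²` tail of the
  Jastrow pseudopotential of a Bose fluid with phonons, `u(r) ∼ -(m v_s/ħπ²ρ) r⁻²`, `ĉ(k) → -2mv_s/ħk`,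
  Reatto–Chester 1967, as printed in [MarchTosi1976, Ch. 8, §8.2, (8.13)–(8.15)]).
* `IsPairPotential L U` (measurable, even, periodic `U : ℝ³ → ℝ`), the pair family
  `pairKernelFamily U` (`u₂(x₁,x₂) = U(x₁ - x₂)`, `u_k = 0` otherwise) and the expansion
  `IsPairPotential.expansion`; radial-in-the-torus-distance potentials `w(‖reduce L y‖)` and the core
  potential `-log Φ`, `Φ = φ ∘ reduce L` of a pair profile (`IsPairProfile`) are pair potentials.
* `HasCoreTail u b C φ T`: the pair kernel of `u` is `-log Φ(x₁ - x₂) + T(x₁ - x₂)` with `φ` a pair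
  profile of range `b` (`0 ≤ φ ≤ 1`, `φ = 1` off `B_b`, `2b ≤ L`) and `T` a Reatto–Chester tail.
* API: extensionality, additivity of `logAmplitude`, translation/periodicity/permutation invariance
  of `logAmplitude`, `Represents.mul`, subadditivity of the norms (`polymerNorm_sum_le`), monotonicity
  in the weight, and the Jastrow case: the product state `∏_{i<j} Φ(xᵢ - xⱼ)` is represented by the
  expansion of `-log Φ` (`IsPairProfile.represents_jastrowC`), whose polymer norm vanishes.

## Design choices

* Kernels are indexed by all `k : ℕ` (a dependent family `(k : ℕ) → Config k → ℝ`), so that the order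
  of a subset `A` is literally `A.card`; the sum defining `logAmplitude` only meets `2 ≤ k ≤ N`.
  One-body kernels are excluded as in the request (on the torus a translation-invariant `u₁` is a
  constant); the constant is the `∃ c` of `Represents`.
* `Represents` constrains the modulus `‖Ψ‖` on `{Ψ ≠ 0}` only: for hard cores `Ψ` vanishes on core
  overlaps, where `-log Ψ = +∞` has no real-valued expansion (and `Real.log 0 = 0` is a junk value
  inside `-log Φ`).
* Pair kernels are `U(x₁ - x₂)` for an even `Lℤ³`-periodic `U` on `ℝ³` rather than a radial profile
  of the torus distance: this contains the radial case (`IsPairPotential.radial`) and also lattice sums /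
  Fourier series with only cubic symmetry, which is what a periodised `1/r²` tail is.
* Norms are `ℝ≥0∞`-valued lower Lebesgue integrals over the cell (`cellN m L = [0,L)^{3m}`), the weight
  enters as `(ENNReal.ofReal w)⁻¹ ^ j` (so `w ≤ 0` gives weight `⊤`, not a junk `0`).
* Mathlib has no cluster/polymer expansion objects (searched `polymer`, `cluster expansion`, `Jastrow`,
  `Ursell`); `Finset.powersetCard`, `Finset.orderEmbOfFin`, `Matrix.vecCons`, `lintegral`, the Bochner
  integral and `Equiv.finsetCongr` are Mathlib's; `cell`, `cellN`, `latticeVec`, `reduce`, `pairFactor`,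
  `IsPairProfile`, `jastrow`, `pairsOf`, `cellWave` are the companions'.
* Not here: the Riccati (eigenvalue) equation for `S`, Banach-space completeness of the normed kernel
  space, convergence of `N → ∞` kernels, hard cores inside the expansion, one-body (wall) kernels.

## References

* [KirkwoodThomas1983] J. R. Kirkwood, L. E. Thomas, *Expansions and phase transitions for the ground
  state of quantum Ising lattice systems*, Comm. Math. Phys. 88 (1983) 569–580: §II, (2.1)–(2.4),
  Thm. 2.1.
* [BrydgesFederbush1980] D. C. Brydges, P. Federbush, *Debye screening*, Comm. Math. Phys. 73 (1980)
  197–246: Lemma 9.6 (9.411), App. 1 (A1.9).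
* [MarchTosi1976] N. H. March, M. P. Tosi, *Atomic Dynamics in Liquids*, Macmillan 1976: Ch. 8, §8.2,
  (8.13)–(8.17) (the Jastrow–Bijl function and its `r⁻²` tail, after Reatto–Chester).
* [ReattoChester1967] L. Reatto, G. V. Chester, *Phonons and the properties of a Bose system*,
  Phys. Rev. 155 (1967) 88–100 (original source of the tail; not held, acq-02636).
-/

noncomputable section

open MeasureTheory Finset
open scoped ENNReal NNReal ComplexConjugate

namespace Literature.MathematicalPhysics.QuantumManyBody.BoseGas

/-! ### Sub-configurations -/

section SubConfig

variable {N : ℕ}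

/-- `X_A`: the positions of the particles with labels in `A ⊆ {0, …, N-1}`, listed in increasing order
of the labels — a configuration of `|A|` particles. [folklore] -/
def subConfig (X : Config N) (A : Finset (Fin N)) : Config A.card :=
  fun i => X (A.orderEmbOfFin rfl i)

/-- Unfolding `subConfig`. [folklore] -/
theorem subConfig_apply (X : Config N) (A : Finset (Fin N)) (i : Fin A.card) :
    subConfig X A i = X (A.orderEmbOfFin rfl i) := rfl

/-- Evaluating a dependent family at `X_A`, with the order `|A|` replaced by a propositionally equal
`k` (the only way the dependent index is ever discharged). [folklore] -/
theorem apply_card_subConfig {β : Sort*} (F : (k : ℕ) → Config k → β) (X : Config N)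
    (A : Finset (Fin N)) {k : ℕ} (h : A.card = k) :
    F A.card (subConfig X A) = F k (fun i => X (A.orderEmbOfFin h i)) := by
  subst h; rfl

/-- `X_A` commutes with a common translation of all particles. [folklore] -/
theorem subConfig_add_const (X : Config N) (a : Space) (A : Finset (Fin N)) :
    subConfig (fun i => X i + a) A = fun i => subConfig X A i + a := rfl

/-- Moving a particle outside `A` does not change `X_A`. [folklore] -/
theorem subConfig_add_single_of_notMem (X : Config N) (A : Finset (Fin N)) {i : Fin N} (hi : i ∉ A)
    (v : Space) : subConfig (X + Pi.single i v) A = subConfig X A := by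
  funext m
  have hne : A.orderEmbOfFin rfl m ≠ i := fun h => hi (h ▸ A.orderEmbOfFin_mem rfl m)
  simp [subConfig, hne]

/-- Moving the particle of `A` with rank `m` moves the `m`-th entry of `X_A`. [folklore] -/
theorem subConfig_add_single_orderEmbOfFin (X : Config N) (A : Finset (Fin N)) (m : Fin A.card)
    (v : Space) :
    subConfig (X + Pi.single (A.orderEmbOfFin rfl m) v) A = subConfig X A + Pi.single m v := by
  funext m'
  by_cases h : m' = m
  · subst h; simp [subConfig]
  · have hne : A.orderEmbOfFin rfl m' ≠ A.orderEmbOfFin rfl m :=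
      fun h' => h ((A.orderEmbOfFin rfl).injective h')
    simp [subConfig, hne, h]

end SubConfig

/-! ### Kernel families -/

/-- A **many-body kernel expansion** for `N` particles on the torus `ℝ³/Lℤ³`: a family of `k`-body
kernels `u_k : (ℝ³)^k → ℝ` (all `k : ℕ`; only `2 ≤ k ≤ N` are ever evaluated), each measurable,
symmetric under permutations of its arguments, invariant under a common translation, and
`Lℤ³`-periodic in each argument (stated on the generators `L e_j`). The represented log-amplitude is
`logAmplitude u X = ∑_{k=2}^N ∑_{|A|=k} u_k(X_A)` (continuum analogue of the lattice expansion
`-log ψ_Λ(σ) = ½ ∑_{A ⊂ Λ} J_Λ(A) σ(A)` of a positive ground state).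
[cite: KirkwoodThomas1983, §II (2.1)–(2.3)] -/
structure ManyBodyKernelExpansion (N : ℕ) (L : ℝ) where
  /-- The `k`-body kernel `u_k`. -/
  kernel : (k : ℕ) → Config k → ℝ
  /-- Each kernel is (Borel) measurable. -/
  measurable : ∀ k, Measurable (kernel k)
  /-- Symmetry: `u_k(y_{σ(1)}, …, y_{σ(k)}) = u_k(y_1, …, y_k)`. -/
  symm : ∀ (k : ℕ) (σ : Equiv.Perm (Fin k)) (Y : Config k), kernel k (Y ∘ σ) = kernel k Y
  /-- Translation invariance: `u_k(y_1 + a, …, y_k + a) = u_k(y_1, …, y_k)`. -/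
  transl : ∀ (k : ℕ) (a : Space) (Y : Config k), kernel k (fun i => Y i + a) = kernel k Y
  /-- Periodicity in each variable: `u_k(…, y_i + L e_j, …) = u_k(…, y_i, …)`. -/
  periodic : ∀ (k : ℕ) (Y : Config k) (i : Fin k) (j : Fin 3),
    kernel k (Y + Pi.single i (EuclideanSpace.single j L)) = kernel k Y

namespace ManyBodyKernelExpansion

variable {N : ℕ} {L : ℝ}

/-- A kernel expansion is determined by its kernels. [folklore] -/
theorem kernel_injective :
    Function.Injective (kernel : ManyBodyKernelExpansion N L → (k : ℕ) → Config k → ℝ) := by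
  rintro ⟨u, _, _, _, _⟩ ⟨v, _, _, _, _⟩ h
  cases h
  rfl

/-- Extensionality on kernels. [folklore] -/
@[ext]
theorem ext {u v : ManyBodyKernelExpansion N L} (h : ∀ k Y, u.kernel k Y = v.kernel k Y) : u = v :=
  kernel_injective (funext fun k => funext (h k))

/-- The zero expansion (all kernels vanish; represents the constants). [folklore] -/
instance : Zero (ManyBodyKernelExpansion N L) :=
  ⟨{ kernel := fun _ _ => 0
     measurable := fun _ => measurable_const
     symm := fun _ _ _ => rfl
     transl := fun _ _ _ => rfl
     periodic := fun _ _ _ _ => rfl }⟩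

/-- Kernelwise sum of two expansions (represents the product of the represented functions,
`Represents.mul`). [folklore] -/
instance : Add (ManyBodyKernelExpansion N L) :=
  ⟨fun u v =>
    { kernel := fun k Y => u.kernel k Y + v.kernel k Y
      measurable := fun k => (u.measurable k).add (v.measurable k)
      symm := fun k σ Y => by rw [u.symm, v.symm]
      transl := fun k a Y => by rw [u.transl, v.transl]
      periodic := fun k Y i j => by rw [u.periodic, v.periodic] }⟩

/-- Kernelwise multiple by a natural number. [folklore] -/
instance : SMul ℕ (ManyBodyKernelExpansion N L) :=
  ⟨fun n u =>
    { kernel := fun k Y => n • u.kernel k Y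
      measurable := fun k => by
        simpa only [nsmul_eq_mul] using (u.measurable k).const_mul (n : ℝ)
      symm := fun k σ Y => by rw [u.symm]
      transl := fun k a Y => by rw [u.transl]
      periodic := fun k Y i j => by rw [u.periodic] }⟩

/-- Kernelwise multiple by a real number (e.g. `2 • u` represents `|Ψ|²`). [folklore] -/
instance : SMul ℝ (ManyBodyKernelExpansion N L) :=
  ⟨fun c u =>
    { kernel := fun k Y => c * u.kernel k Y
      measurable := fun k => (u.measurable k).const_mul c
      symm := fun k σ Y => by rw [u.symm]
      transl := fun k a Y => by rw [u.transl]
      periodic := fun k Y i j => by rw [u.periodic] }⟩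

/-- Kernels of `0`. [folklore] -/
@[simp]
theorem zero_kernel (k : ℕ) (Y : Config k) : (0 : ManyBodyKernelExpansion N L).kernel k Y = 0 := rfl

/-- Kernels of a sum. [folklore] -/
@[simp]
theorem add_kernel (u v : ManyBodyKernelExpansion N L) (k : ℕ) (Y : Config k) :
    (u + v).kernel k Y = u.kernel k Y + v.kernel k Y := rfl

/-- Kernels of a natural multiple. [folklore] -/
@[simp]
theorem nsmul_kernel (n : ℕ) (u : ManyBodyKernelExpansion N L) (k : ℕ) (Y : Config k) :
    (n • u).kernel k Y = n • u.kernel k Y := rfl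

/-- Kernels of a real multiple. [folklore] -/
@[simp]
theorem smul_kernel (c : ℝ) (u : ManyBodyKernelExpansion N L) (k : ℕ) (Y : Config k) :
    (c • u).kernel k Y = c * u.kernel k Y := rfl

/-- Kernel expansions form an additive commutative monoid (kernelwise). [folklore] -/
instance : AddCommMonoid (ManyBodyKernelExpansion N L) :=
  kernel_injective.addCommMonoid _ rfl (fun _ _ => rfl) fun _ _ => rfl

/-- Kernels of a finite sum of expansions. [folklore] -/
@[simp]
theorem sum_kernel {ι : Type*} (s : Finset ι) (u : ι → ManyBodyKernelExpansion N L) (k : ℕ)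
    (Y : Config k) : (∑ i ∈ s, u i).kernel k Y = ∑ i ∈ s, (u i).kernel k Y := by
  classical
  induction s using Finset.induction_on with
  | empty => simp
  | insert a s ha ih => simp [Finset.sum_insert ha, ih]

/-! ### The log-amplitude and the representation predicate -/

/-- The **log-amplitude** `S(X) = ∑_{k=2}^{N} ∑_{A ⊆ Fin N, |A| = k} u_{|A|}(X_A)` of a configuration of
`N` particles (the double sum over orders and subsets; `X_A = subConfig X A` lists the particles of `A`
in increasing order, immaterial by symmetry of the kernels). [cite: KirkwoodThomas1983, §II (2.2)–(2.3)] -/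
def logAmplitude (u : ManyBodyKernelExpansion N L) (X : Config N) : ℝ :=
  ∑ k ∈ Icc 2 N, ∑ A ∈ powersetCard k (univ : Finset (Fin N)), u.kernel A.card (subConfig X A)

/-- **`u` represents `Ψ`**: `Ψ = e^{-S}` in modulus up to normalisation, i.e. there is a constant `c`
with `‖Ψ(X)‖ = exp(-(S(X) + c))` at every configuration where `Ψ(X) ≠ 0` (for a positive `Ψ` this is
`-log Ψ = S + c` off the zero set; on core overlaps of a hard-core state nothing is asked).
[cite: KirkwoodThomas1983, §II (2.1)–(2.2)] -/
def Represents (Ψ : Config N → ℂ) (u : ManyBodyKernelExpansion N L) : Prop :=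
  ∃ c : ℝ, ∀ X, Ψ X ≠ 0 → ‖Ψ X‖ = Real.exp (-(u.logAmplitude X + c))

/-- `Represents` in logarithmic form: `-log ‖Ψ(X)‖ = S(X) + c` off the zero set of `Ψ`
(the form `-log Ψ = ∑_k ∑_A u_k(X_A) + const` of the request). [folklore] -/
theorem represents_iff_neg_log (Ψ : Config N → ℂ) (u : ManyBodyKernelExpansion N L) :
    Represents Ψ u ↔ ∃ c : ℝ, ∀ X, Ψ X ≠ 0 → -Real.log ‖Ψ X‖ = u.logAmplitude X + c := by
  refine exists_congr fun c => forall_congr' fun X => imp_congr_right fun hX => ?_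
  constructor
  · intro h
    rw [h, Real.log_exp, neg_neg]
  · intro h
    rw [← Real.exp_log (norm_pos_iff.mpr hX), ← neg_neg (Real.log ‖Ψ X‖), h]

/-- The log-amplitude as a single sum over the subsets with at least two elements. [folklore] -/
theorem logAmplitude_eq_sum_filter (u : ManyBodyKernelExpansion N L) (X : Config N) :
    u.logAmplitude X =
      ∑ A ∈ (univ : Finset (Fin N)).powerset with 2 ≤ A.card, u.kernel A.card (subConfig X A) := by
  have hmaps : ∀ A ∈ (univ : Finset (Fin N)).powerset.filter (fun A => 2 ≤ A.card),
      A.card ∈ Icc 2 N := by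
    intro A hA
    simp only [mem_filter, mem_powerset] at hA
    exact mem_Icc.mpr ⟨hA.2, (card_le_univ A).trans_eq (Fintype.card_fin N)⟩
  unfold logAmplitude
  rw [← sum_fiberwise_of_maps_to hmaps]
  refine sum_congr rfl fun k hk => sum_congr ?_ fun _ _ => rfl
  ext A
  simp only [mem_powersetCard, subset_univ, true_and, mem_filter, mem_powerset]
  constructor
  · intro h
    exact ⟨(mem_Icc.mp hk).1.trans_eq h.symm, h⟩
  · exact fun h => h.2

/-- `logAmplitude` is additive in the expansion. [folklore] -/
@[simp]
theorem logAmplitude_add (u v : ManyBodyKernelExpansion N L) (X : Config N) :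
    (u + v).logAmplitude X = u.logAmplitude X + v.logAmplitude X := by
  simp only [logAmplitude, add_kernel, sum_add_distrib]

/-- The zero expansion has zero log-amplitude. [folklore] -/
@[simp]
theorem logAmplitude_zero (X : Config N) : (0 : ManyBodyKernelExpansion N L).logAmplitude X = 0 := by
  simp [logAmplitude]

/-- `logAmplitude` is homogeneous in the expansion. [folklore] -/
@[simp]
theorem logAmplitude_smul (c : ℝ) (u : ManyBodyKernelExpansion N L) (X : Config N) :
    (c • u).logAmplitude X = c * u.logAmplitude X := by
  simp only [logAmplitude, smul_kernel, mul_sum]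

/-- `logAmplitude` of a finite sum of expansions. [folklore] -/
theorem logAmplitude_sum {ι : Type*} (s : Finset ι) (u : ι → ManyBodyKernelExpansion N L)
    (X : Config N) : (∑ i ∈ s, u i).logAmplitude X = ∑ i ∈ s, (u i).logAmplitude X := by
  classical
  induction s using Finset.induction_on with
  | empty => simp
  | insert a s ha ih => simp [Finset.sum_insert ha, ih]

/-- **Translation invariance** of the log-amplitude. [folklore] -/
theorem logAmplitude_add_const (u : ManyBodyKernelExpansion N L) (X : Config N) (a : Space) :
    u.logAmplitude (fun i => X i + a) = u.logAmplitude X := by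
  simp only [logAmplitude, subConfig_add_const, u.transl]

/-- **Periodicity** of the log-amplitude in each particle. [folklore] -/
theorem logAmplitude_add_single (u : ManyBodyKernelExpansion N L) (X : Config N) (i : Fin N)
    (j : Fin 3) : u.logAmplitude (X + Pi.single i (EuclideanSpace.single j L)) = u.logAmplitude X := by
  unfold logAmplitude
  refine sum_congr rfl fun k _ => sum_congr rfl fun A _ => ?_
  by_cases hi : i ∈ A
  · obtain ⟨m, hm⟩ : ∃ m : Fin A.card, A.orderEmbOfFin rfl m = i := by
      have : i ∈ Set.range (A.orderEmbOfFin rfl) := by rw [range_orderEmbOfFin]; exact hi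
      exact this
    rw [← hm, subConfig_add_single_orderEmbOfFin, u.periodic]
  · rw [subConfig_add_single_of_notMem X A hi]

/-- Re-listing a subset through a permutation: for `B = σ(A)` the increasing enumerations of `A`
(pushed through `σ`) and of `B` differ by a permutation of the ranks. [folklore] -/
theorem exists_perm_orderEmbOfFin_map (σ : Equiv.Perm (Fin N)) (A : Finset (Fin N)) {k : ℕ}
    (hA : A.card = k) (hB : (A.map σ.toEmbedding).card = k) :
    ∃ τ : Equiv.Perm (Fin k),
      ∀ i, σ (A.orderEmbOfFin hA i) = (A.map σ.toEmbedding).orderEmbOfFin hB (τ i) := by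
  let e : {x // x ∈ A} ≃ {x // x ∈ A.map σ.toEmbedding} := σ.subtypeEquiv fun a => by
    rw [Finset.mem_map_equiv, Equiv.symm_apply_apply]
  refine ⟨(A.orderIsoOfFin hA).toEquiv.trans
    (e.trans ((A.map σ.toEmbedding).orderIsoOfFin hB).symm.toEquiv), fun i => ?_⟩
  change σ (A.orderEmbOfFin hA i) = (A.map σ.toEmbedding).orderEmbOfFin hB
    (((A.map σ.toEmbedding).orderIsoOfFin hB).symm (e (A.orderIsoOfFin hA i)))
  rw [← coe_orderIsoOfFin_apply (A.map σ.toEmbedding) hB, OrderIso.apply_symm_apply]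
  rfl

/-- **Permutation invariance** of the log-amplitude (Bose symmetry of the represented state).
[folklore] -/
theorem logAmplitude_comp_perm (u : ManyBodyKernelExpansion N L) (σ : Equiv.Perm (Fin N))
    (X : Config N) : u.logAmplitude (X ∘ σ) = u.logAmplitude X := by
  unfold logAmplitude
  refine sum_congr rfl fun k _ => ?_
  refine sum_equiv σ.finsetCongr (fun A => ?_) (fun A hA => ?_)
  · simp only [mem_powersetCard, subset_univ, true_and, Equiv.finsetCongr_apply, card_map]
  · have hAk : A.card = k := (mem_powersetCard.mp hA).2
    have hBk : (A.map σ.toEmbedding).card = k := by rw [card_map, hAk]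
    rw [Equiv.finsetCongr_apply, apply_card_subConfig u.kernel (X ∘ σ) A hAk,
      apply_card_subConfig u.kernel X _ hBk]
    obtain ⟨τ, hτ⟩ := exists_perm_orderEmbOfFin_map σ A hAk hBk
    have : (fun i => (X ∘ σ) (A.orderEmbOfFin hAk i)) =
        (fun i => X ((A.map σ.toEmbedding).orderEmbOfFin hBk i)) ∘ τ := by
      funext i; simp only [Function.comp_apply, hτ]
    rw [this, u.symm]

/-- The product of represented functions is represented by the sum of the expansions. [folklore] -/
theorem Represents.mul {Ψ Φ : Config N → ℂ} {u v : ManyBodyKernelExpansion N L}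
    (hΨ : Represents Ψ u) (hΦ : Represents Φ v) : Represents (Ψ * Φ) (u + v) := by
  obtain ⟨c, hc⟩ := hΨ
  obtain ⟨d, hd⟩ := hΦ
  refine ⟨c + d, fun X hX => ?_⟩
  have h1 : Ψ X ≠ 0 := fun h => hX (by simp [h])
  have h2 : Φ X ≠ 0 := fun h => hX (by simp [h])
  rw [Pi.mul_apply, norm_mul, hc X h1, hd X h2, ← Real.exp_add, logAmplitude_add]
  congr 1
  ring

/-- A represented function is, in modulus, invariant under common translations off its zero set.
[folklore] -/
theorem Represents.norm_add_const {Ψ : Config N → ℂ} {u : ManyBodyKernelExpansion N L}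
    (h : Represents Ψ u) (X : Config N) (a : Space) (hX : Ψ X ≠ 0)
    (hXa : Ψ (fun i => X i + a) ≠ 0) : ‖Ψ (fun i => X i + a)‖ = ‖Ψ X‖ := by
  obtain ⟨c, hc⟩ := h
  rw [hc _ hXa, hc _ hX, logAmplitude_add_const]

/-! ### Norms -/

/-- `Y ↦ (x, Y)`: prepending a first particle is measurable. [folklore] -/
theorem measurable_vecCons (x : Space) (m : ℕ) :
    Measurable fun Y : Config m => (Matrix.vecCons x Y : Config (m + 1)) := by
  refine measurable_pi_iff.mpr fun i => ?_
  induction i using Fin.cases with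
  | zero => simp
  | succ j => simpa using measurable_pi_apply j

/-- The **`sup–L¹` norm** of the `(m+1)`-body kernel: `sup_{x} ∫_{[0,L)^{3m}} |u_{m+1}(x, y_1, …, y_m)| dy`
(supremum over the first variable of the `L¹`-norm over the cell in the others; by symmetry the choice
of the distinguished variable is immaterial). This is the kernel norm bounding the operator norm of a
symmetric integral kernel. [cite: BrydgesFederbush1980, Lemma 9.6 (9.411)] -/
def kernelNorm (u : ManyBodyKernelExpansion N L) (m : ℕ) : ℝ≥0∞ :=
  ⨆ x : Space, ∫⁻ Y in cellN m L, ‖u.kernel (m + 1) (Matrix.vecCons x Y)‖ₑ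

/-- The **polymer norm** of the higher kernels with weight `w`:
`‖u‖_w = ∑_{k=3}^{N} w^{-(k-2)} sup_{x₁} ∫_{cell^{k-1}} |u_k(x₁, x₂, …, x_k)| dx₂ ⋯ dx_k ∈ [0, ∞]`,
written as the sum over `j = k - 2 ∈ [1, N-2]` of `w^{-j} · kernelNorm u (j+1)` (empty for `N ≤ 2`);
intended weight `w = √(ρa³) ∈ (0,1)`, so that `‖u‖_w ≤ M` says the `k`-body kernel is
`O(M (ρa³)^{(k-2)/2})` in `sup–L¹`. (A geometrically weighted activity norm in the sense of polymer
expansions; the weight-per-excess-order bookkeeping of the lattice precedent is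
[KirkwoodThomas1983, Thm. 2.1 (ii)].) [folklore] -/
def polymerNorm (w : ℝ) (u : ManyBodyKernelExpansion N L) : ℝ≥0∞ :=
  ∑ j ∈ Icc 1 (N - 2), (ENNReal.ofReal w)⁻¹ ^ j * u.kernelNorm (j + 1)

/-- The kernels of `0` have norm `0`. [folklore] -/
@[simp]
theorem kernelNorm_zero (m : ℕ) : (0 : ManyBodyKernelExpansion N L).kernelNorm m = 0 := by
  simp [kernelNorm]

/-- **Subadditivity** of the kernel norm. [folklore] -/
theorem kernelNorm_add_le (u v : ManyBodyKernelExpansion N L) (m : ℕ) :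
    (u + v).kernelNorm m ≤ u.kernelNorm m + v.kernelNorm m := by
  refine iSup_le fun x => ?_
  have hu : Measurable fun Y : Config m => ‖u.kernel (m + 1) (Matrix.vecCons x Y)‖ₑ :=
    ((u.measurable (m + 1)).comp (measurable_vecCons x m)).enorm
  calc ∫⁻ Y in cellN m L, ‖(u + v).kernel (m + 1) (Matrix.vecCons x Y)‖ₑ
      ≤ ∫⁻ Y in cellN m L, ‖u.kernel (m + 1) (Matrix.vecCons x Y)‖ₑ +
          ‖v.kernel (m + 1) (Matrix.vecCons x Y)‖ₑ :=
        lintegral_mono fun Y => enorm_add_le _ _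
    _ = (∫⁻ Y in cellN m L, ‖u.kernel (m + 1) (Matrix.vecCons x Y)‖ₑ) +
          ∫⁻ Y in cellN m L, ‖v.kernel (m + 1) (Matrix.vecCons x Y)‖ₑ := lintegral_add_left hu _
    _ ≤ u.kernelNorm m + v.kernelNorm m :=
        add_le_add (le_iSup (fun x => ∫⁻ Y in cellN m L, ‖u.kernel (m + 1) (Matrix.vecCons x Y)‖ₑ) x)
          (le_iSup (fun x => ∫⁻ Y in cellN m L, ‖v.kernel (m + 1) (Matrix.vecCons x Y)‖ₑ) x)

/-- **Homogeneity** of the kernel norm. [folklore] -/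
theorem kernelNorm_smul (c : ℝ) (u : ManyBodyKernelExpansion N L) (m : ℕ) :
    (c • u).kernelNorm m = ‖c‖ₑ * u.kernelNorm m := by
  unfold kernelNorm
  rw [ENNReal.mul_iSup]
  refine iSup_congr fun x => ?_
  have hu : Measurable fun Y : Config m => ‖u.kernel (m + 1) (Matrix.vecCons x Y)‖ₑ :=
    ((u.measurable (m + 1)).comp (measurable_vecCons x m)).enorm
  rw [← lintegral_const_mul _ hu]
  simp only [smul_kernel, enorm_mul]

/-- The polymer norm of `0` vanishes. [folklore] -/
@[simp]
theorem polymerNorm_zero (w : ℝ) : (0 : ManyBodyKernelExpansion N L).polymerNorm w = 0 := by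
  simp [polymerNorm]

/-- **Subadditivity** of the polymer norm. [folklore] -/
theorem polymerNorm_add_le (w : ℝ) (u v : ManyBodyKernelExpansion N L) :
    (u + v).polymerNorm w ≤ u.polymerNorm w + v.polymerNorm w := by
  unfold polymerNorm
  rw [← sum_add_distrib]
  refine sum_le_sum fun j _ => ?_
  rw [← mul_add]
  exact mul_le_mul_right (kernelNorm_add_le u v _) _

/-- **Norm of a finite sum**: `‖∑ᵢ uᵢ‖_w ≤ ∑ᵢ ‖uᵢ‖_w`. [folklore] -/
theorem polymerNorm_sum_le {ι : Type*} (w : ℝ) (s : Finset ι)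
    (u : ι → ManyBodyKernelExpansion N L) :
    (∑ i ∈ s, u i).polymerNorm w ≤ ∑ i ∈ s, (u i).polymerNorm w :=
  Finset.le_sum_of_subadditive (polymerNorm w) (polymerNorm_zero w).le (polymerNorm_add_le w) s u

/-- **Homogeneity** of the polymer norm. [folklore] -/
theorem polymerNorm_smul (w c : ℝ) (u : ManyBodyKernelExpansion N L) :
    (c • u).polymerNorm w = ‖c‖ₑ * u.polymerNorm w := by
  simp only [polymerNorm, kernelNorm_smul, mul_sum]
  refine sum_congr rfl fun j _ => ?_
  ring

/-- The polymer norm decreases as the weight increases (`w ≤ w'` gives `‖u‖_{w'} ≤ ‖u‖_w`).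
[folklore] -/
theorem polymerNorm_anti {w w' : ℝ} (h : w ≤ w') (u : ManyBodyKernelExpansion N L) :
    u.polymerNorm w' ≤ u.polymerNorm w := by
  refine sum_le_sum fun j _ => mul_le_mul_left ?_ _
  exact pow_le_pow_left₀ zero_le (ENNReal.inv_le_inv.mpr (ENNReal.ofReal_le_ofReal h)) j

/-- For `N ≤ 2` there are no higher kernels and the polymer norm vanishes. [folklore] -/
theorem polymerNorm_of_le_two (hN : N ≤ 2) (w : ℝ) (u : ManyBodyKernelExpansion N L) :
    u.polymerNorm w = 0 := by
  have : Icc 1 (N - 2) = ∅ := by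
    ext j; simp only [mem_Icc, Finset.notMem_empty, iff_false]; omega
  simp [polymerNorm, this]

/-- A bound on the polymer norm bounds each higher kernel: for `3 ≤ k ≤ N` (`k = j + 2`),
`sup_{x} ∫ |u_k(x, ·)| ≤ w^{k-2} ‖u‖_w`. [folklore] -/
theorem kernelNorm_le_of_polymerNorm_le {w : ℝ} (hw : 0 < w) (u : ManyBodyKernelExpansion N L)
    {M : ℝ≥0∞} (hM : u.polymerNorm w ≤ M) {j : ℕ} (hj : 1 ≤ j) (hjN : j + 2 ≤ N) :
    u.kernelNorm (j + 1) ≤ ENNReal.ofReal w ^ j * M := by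
  have hmem : j ∈ Icc 1 (N - 2) := mem_Icc.mpr ⟨hj, by omega⟩
  have hw0 : ENNReal.ofReal w ≠ 0 := by rwa [Ne, ENNReal.ofReal_eq_zero, not_le]
  have h1 : (ENNReal.ofReal w)⁻¹ ^ j * u.kernelNorm (j + 1) ≤ M :=
    (single_le_sum_of_canonicallyOrdered
      (f := fun j => (ENNReal.ofReal w)⁻¹ ^ j * u.kernelNorm (j + 1)) hmem).trans hM
  calc u.kernelNorm (j + 1)
      = ENNReal.ofReal w ^ j * ((ENNReal.ofReal w)⁻¹ ^ j * u.kernelNorm (j + 1)) := by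
        rw [← mul_assoc, ← mul_pow, ENNReal.mul_inv_cancel hw0 ENNReal.ofReal_ne_top, one_pow,
          one_mul]
    _ ≤ ENNReal.ofReal w ^ j * M := mul_le_mul_right h1 _

end ManyBodyKernelExpansion

/-! ### The Reatto–Chester tail class -/

/-- **Reatto–Chester tails.** A function `T` on the cell of side `L` (an `Lℤ³`-periodic function on `ℝ³`
restricted to its fundamental domain) is in the tail class with constant `C` if it is integrable on the
cell and its unnormalised torus Fourier coefficients `T̂(p) = ∫_{[0,L)³} e^{-ip·x} T(x) dx`,
`p = 2πn/L`, obey `|T̂(p)| ≤ C/|p|` for all `n ∈ ℤ³ ∖ {0}` (nothing is asked of the mean `T̂(0)`).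
This is the class of the long-range part of the Jastrow pseudopotential of a Bose fluid with phonons:
`u(r) ∼ -(m v_s / ħπ²ρ) r⁻²`, equivalently `û(k) ∼ -2m v_s/(ħρk)` as `k → 0` (Reatto–Chester 1967),
written on the torus. [cite: MarchTosi1976, Ch. 8 §8.2 (8.13)–(8.15)] -/
def IsReattoChesterTail (L C : ℝ) (T : Space → ℝ) : Prop :=
  IntegrableOn T (cell L) ∧
    ∀ n : Fin 3 → ℤ, n ≠ 0 →
      ‖∫ x in cell L, conj (cellWave L n x) * (T x : ℂ)‖ ≤ C / ‖latticeVec (2 * Real.pi / L) n‖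

namespace IsReattoChesterTail

variable {L C : ℝ} {T : Space → ℝ}

/-- The momenta `p = 2πn/L`, `n ≠ 0`, are non-zero (for `L ≠ 0`). [folklore] -/
theorem norm_latticeVec_pos (hL : L ≠ 0) {n : Fin 3 → ℤ} (hn : n ≠ 0) :
    0 < ‖latticeVec (2 * Real.pi / L) n‖ := by
  obtain ⟨k, hk⟩ : ∃ k, n k ≠ 0 := by
    by_contra h
    push Not at h
    exact hn (funext h)
  have h2 : latticeVec (2 * Real.pi / L) n k ≠ 0 := by
    rw [latticeVec_apply]
    exact mul_ne_zero (div_ne_zero (by positivity) hL) (Int.cast_ne_zero.mpr hk)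
  exact (abs_pos.mpr h2).trans_le (abs_apply_le_norm _ k)

/-- The integrand `conj(e_n) · T` of a Fourier coefficient is integrable on the cell when `T` is.
[folklore] -/
theorem integrableOn_conj_cellWave_mul (hT : IntegrableOn T (cell L)) (n : Fin 3 → ℤ) :
    IntegrableOn (fun x => conj (cellWave L n x) * (T x : ℂ)) (cell L) := by
  have hT' : IntegrableOn (fun x => (T x : ℂ)) (cell L) := hT.ofReal
  exact hT'.bdd_mul (c := 1)
    (Complex.continuous_conj.comp (contDiff_cellWave L n).continuous).aestronglyMeasurable
    (ae_of_all _ fun x => le_of_eq (by rw [Complex.norm_conj, norm_cellWave]))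

/-- The zero function is a tail (for `C ≥ 0`). [folklore] -/
theorem zero (L : ℝ) (hC : 0 ≤ C) : IsReattoChesterTail L C 0 := by
  refine ⟨integrableOn_zero, fun n _ => ?_⟩
  simp only [Pi.zero_apply, Complex.ofReal_zero, mul_zero, integral_zero, norm_zero]
  positivity

/-- The tail class grows with the constant. [folklore] -/
theorem mono (h : IsReattoChesterTail L C T) {C' : ℝ} (hC : C ≤ C') : IsReattoChesterTail L C' T :=
  ⟨h.1, fun n hn => (h.2 n hn).trans (div_le_div_of_nonneg_right hC (norm_nonneg _))⟩

/-- Sums of tails are tails, with the sum of the constants. [folklore] -/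
theorem add {C' : ℝ} {T' : Space → ℝ} (h : IsReattoChesterTail L C T)
    (h' : IsReattoChesterTail L C' T') : IsReattoChesterTail L (C + C') (T + T') := by
  refine ⟨h.1.add h'.1, fun n hn => ?_⟩
  have hsplit : (fun x => conj (cellWave L n x) * ((T + T') x : ℂ)) = fun x =>
      conj (cellWave L n x) * (T x : ℂ) + conj (cellWave L n x) * (T' x : ℂ) := by
    funext x
    simp only [Pi.add_apply, Complex.ofReal_add, mul_add]
  rw [hsplit, integral_add (integrableOn_conj_cellWave_mul h.1 n)
    (integrableOn_conj_cellWave_mul h'.1 n), add_div]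
  exact (norm_add_le _ _).trans (add_le_add (h.2 n hn) (h'.2 n hn))

/-- Real multiples of tails are tails. [folklore] -/
theorem const_mul (h : IsReattoChesterTail L C T) (c : ℝ) :
    IsReattoChesterTail L (|c| * C) (fun x => c * T x) := by
  refine ⟨h.1.const_mul c, fun n hn => ?_⟩
  have hsplit : (fun x => conj (cellWave L n x) * ((c * T x : ℝ) : ℂ)) = fun x =>
      (c : ℂ) * (conj (cellWave L n x) * (T x : ℂ)) := by
    funext x
    push_cast
    ring
  rw [hsplit, integral_const_mul, norm_mul, Complex.norm_real, Real.norm_eq_abs, mul_div_assoc]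
  exact mul_le_mul_of_nonneg_left (h.2 n hn) (abs_nonneg c)

/-- In terms of the normalised coefficients `ĉₙ = L⁻³ ∫ conj(eₙ) T` of `PeriodicBoseGasFourier.lean`:
`‖ĉₙ(T)‖ ≤ C / (L³ |p|)`. [folklore] -/
theorem norm_cellFourierCoeff_le (h : IsReattoChesterTail L C T) (hL : 0 < L) {n : Fin 3 → ℤ}
    (hn : n ≠ 0) :
    ‖cellFourierCoeff L (fun x => (T x : ℂ)) n‖ ≤
      C / (L ^ 3 * ‖latticeVec (2 * Real.pi / L) n‖) := by
  rw [cellFourierCoeff_eq_integral hL, norm_smul, Real.norm_eq_abs, abs_inv,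
    abs_of_pos (by positivity : (0 : ℝ) < L ^ 3)]
  calc (L ^ 3)⁻¹ * ‖∫ x in cell L, conj (cellWave L n x) * (T x : ℂ)‖
      ≤ (L ^ 3)⁻¹ * (C / ‖latticeVec (2 * Real.pi / L) n‖) :=
        mul_le_mul_of_nonneg_left (h.2 n hn) (by positivity)
    _ = C / (L ^ 3 * ‖latticeVec (2 * Real.pi / L) n‖) := by ring

end IsReattoChesterTail

/-! ### Measurability and evenness of the lattice reduction -/

section Reduce

variable {L : ℝ}

/-- The lattice reduction `y ↦ y - L n(y)` is measurable. [folklore] -/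
theorem measurable_reduce (L : ℝ) : Measurable (reduce L) := by
  have hk : ∀ k : Fin 3, Measurable fun y : Space => L * ((nearestLat L y k : ℤ) : ℝ) := by
    intro k
    have h1 : Measurable fun y : Space => y k / L :=
      ((measurable_pi_apply k).comp (WithLp.measurable_ofLp 2 (Fin 3 → ℝ))).div_const L
    have h2 : Measurable fun y : Space => round (y k / L) := by
      simp_rw [round_eq]
      exact Measurable.comp Int.measurable_floor (h1.add_const _)
    exact ((measurable_from_top (f := (Int.cast : ℤ → ℝ))).comp h2).const_mul L
  exact measurable_id.sub ((WithLp.measurable_toLp 2 _).comp (measurable_pi_lambda _ hk))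

/-- The coordinates of `reduce L (-y)` and `reduce L y` agree in absolute value (they are opposite
except on the boundary of the Voronoi cell, and the distance to the nearest integer
`|t - round t| = min(fract t, 1 - fract t)` is even). [folklore] -/
theorem abs_reduce_neg_apply (L : ℝ) (y : Space) (k : Fin 3) :
    |reduce L (-y) k| = |reduce L y k| := by
  have hround : ∀ t : ℝ, |-t - round (-t)| = |t - round t| := fun t => by
    rw [abs_sub_round_eq_min, abs_sub_round_eq_min]
    by_cases h : Int.fract t = 0
    · rw [h, Int.fract_neg_eq_zero.mpr h]
    · rw [Int.fract_neg h, sub_sub_cancel, min_comm]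
  rw [reduce_apply, reduce_apply, PiLp.neg_apply]
  rcases eq_or_ne L 0 with rfl | hL
  · simp
  · set t : ℝ := y k / L with ht
    have hy : y k = L * t := by rw [ht]; field_simp
    rw [hy, show -(L * t) / L = -t by field_simp,
      show -(L * t) - L * (round (-t) : ℝ) = L * (-t - round (-t)) by ring,
      show L * t - L * (round t : ℝ) = L * (t - round t) by ring, abs_mul, abs_mul, hround]

/-- `‖reduce L (-y)‖ = ‖reduce L y‖`: the torus distance is even. [folklore] -/
theorem norm_reduce_neg (L : ℝ) (y : Space) : ‖reduce L (-y)‖ = ‖reduce L y‖ := by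
  simp only [EuclideanSpace.norm_eq, Real.norm_eq_abs, abs_reduce_neg_apply]

end Reduce

/-! ### Pair potentials and the Jastrow case -/

/-- **Pair potentials on the torus**: `U : ℝ³ → ℝ` measurable, even and `Lℤ³`-periodic (on the
generators `L e_j`); the pair kernel `u₂(x₁, x₂) = U(x₁ - x₂)` is then symmetric, translation invariant
and periodic in both variables. [folklore] -/
structure IsPairPotential (L : ℝ) (U : Space → ℝ) : Prop where
  measurable : Measurable U
  even : ∀ y, U (-y) = U y
  periodic : ∀ (y : Space) (j : Fin 3), U (y + EuclideanSpace.single j L) = U y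

/-- The kernel family of a pair potential: `u₂(y₀, y₁) = U(y₀ - y₁)`, all other orders `0` (the
Jastrow–Bijl form `Ψ = ∏_{i<j} e^{½u(x_i - x_j)}` with `U = -½u`). [cite: MarchTosi1976, Ch. 8 §8.2 (8.13)] -/
def pairKernelFamily (U : Space → ℝ) : (k : ℕ) → Config k → ℝ
  | 2, Y => U (Y 0 - Y 1)
  | _, _ => 0

/-- The pair kernel of `pairKernelFamily U`. [folklore] -/
@[simp]
theorem pairKernelFamily_two (U : Space → ℝ) (Y : Config 2) :
    pairKernelFamily U 2 Y = U (Y 0 - Y 1) := rfl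

/-- All kernels of `pairKernelFamily U` of order `≠ 2` vanish. [folklore] -/
theorem pairKernelFamily_of_ne_two (U : Space → ℝ) {k : ℕ} (hk : k ≠ 2) (Y : Config k) :
    pairKernelFamily U k Y = 0 := by
  match k, hk, Y with
  | 0, _, _ => rfl
  | 1, _, _ => rfl
  | 2, h, _ => exact absurd rfl h
  | _ + 3, _, _ => rfl

namespace IsPairPotential

variable {L : ℝ} {U : Space → ℝ}

/-- A periodic potential is periodic under subtraction of the generators too. [folklore] -/
theorem sub_single (hU : IsPairPotential L U) (y : Space) (j : Fin 3) :
    U (y - EuclideanSpace.single j L) = U y := by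
  conv_rhs => rw [← sub_add_cancel y (EuclideanSpace.single j L)]
  rw [hU.periodic]

/-- Sums of pair potentials are pair potentials. [folklore] -/
theorem add {U' : Space → ℝ} (hU : IsPairPotential L U) (hU' : IsPairPotential L U') :
    IsPairPotential L (U + U') where
  measurable := hU.measurable.add hU'.measurable
  even y := by simp only [Pi.add_apply, hU.even, hU'.even]
  periodic y j := by simp only [Pi.add_apply, hU.periodic, hU'.periodic]

/-- Real multiples of pair potentials are pair potentials. [folklore] -/
theorem const_mul (hU : IsPairPotential L U) (c : ℝ) : IsPairPotential L fun y => c * U y where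
  measurable := hU.measurable.const_mul c
  even y := by rw [hU.even]
  periodic y j := by rw [hU.periodic]

/-- **Radial potentials of the torus distance.** For a measurable profile `w : ℝ → ℝ`,
`U(y) = w(‖y - L n(y)‖)` (`reduce L y`, the nearest-image representative) is a pair potential:
even by `norm_reduce_neg`, periodic by `reduce_add_latticeVec`. This is the form
`u₂(x₁, x₂) = w(‖reduce L (x₁ - x₂)‖)` of the request. [folklore] -/
theorem radial (hL : L ≠ 0) {w : ℝ → ℝ} (hw : Measurable w) :
    IsPairPotential L fun y => w ‖reduce L y‖ where
  measurable := hw.comp (measurable_reduce L).norm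
  even y := by rw [norm_reduce_neg]
  periodic y j := by rw [single_eq_latticeVec, reduce_add_latticeVec hL]

/-- **The expansion of a pair potential**: kernels `pairKernelFamily U`, for any particle number `N`.
[cite: MarchTosi1976, Ch. 8 §8.2 (8.13)] -/
def expansion (hU : IsPairPotential L U) (N : ℕ) : ManyBodyKernelExpansion N L where
  kernel := pairKernelFamily U
  measurable k := by
    rcases eq_or_ne k 2 with rfl | hk
    · exact hU.measurable.comp ((measurable_pi_apply 0).sub (measurable_pi_apply 1))
    · rw [show pairKernelFamily U k = fun _ => 0 from funext (pairKernelFamily_of_ne_two U hk)]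
      exact measurable_const
  symm k σ Y := by
    rcases eq_or_ne k 2 with rfl | hk
    · -- the permutations of `Fin 2` are the identity and the transposition
      rcases (show ∀ τ : Equiv.Perm (Fin 2), τ = 1 ∨ τ = Equiv.swap 0 1 by decide) σ with rfl | rfl
      · rfl
      · simp only [pairKernelFamily_two, Function.comp_apply, Equiv.swap_apply_left,
          Equiv.swap_apply_right]
        rw [← hU.even, neg_sub]
    · rw [pairKernelFamily_of_ne_two U hk, pairKernelFamily_of_ne_two U hk]
  transl k a Y := by
    rcases eq_or_ne k 2 with rfl | hk
    · simp only [pairKernelFamily_two, add_sub_add_right_eq_sub]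
    · rw [pairKernelFamily_of_ne_two U hk, pairKernelFamily_of_ne_two U hk]
  periodic k Y i j := by
    rcases eq_or_ne k 2 with rfl | hk
    · simp only [pairKernelFamily_two, Pi.add_apply]
      fin_cases i
      · simp only [Fin.zero_eta, Fin.isValue, Pi.single_eq_same, ne_eq, one_ne_zero,
          not_false_eq_true, Pi.single_eq_of_ne, add_zero]
        rw [add_sub_right_comm, hU.periodic]
      · simp only [Fin.mk_one, Fin.isValue, ne_eq, zero_ne_one, not_false_eq_true,
          Pi.single_eq_of_ne, add_zero, Pi.single_eq_same]
        rw [sub_add_eq_sub_sub, hU.sub_single]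
    · rw [pairKernelFamily_of_ne_two U hk, pairKernelFamily_of_ne_two U hk]

/-- The kernels of the expansion of a pair potential. [folklore] -/
@[simp]
theorem expansion_kernel (hU : IsPairPotential L U) (N k : ℕ) (Y : Config k) :
    (hU.expansion N).kernel k Y = pairKernelFamily U k Y := rfl

/-- For a two-element set, rank `0` is the minimum. [folklore] -/
theorem orderEmbOfFin_two_zero {N : ℕ} {A : Finset (Fin N)} (h : A.card = 2) :
    A.orderEmbOfFin h 0 = A.min' (card_pos.mp (by omega)) :=
  Finset.orderEmbOfFin_zero h (by norm_num)

/-- For a two-element set, rank `1` is the maximum. [folklore] -/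
theorem orderEmbOfFin_two_one {N : ℕ} {A : Finset (Fin N)} (h : A.card = 2) :
    A.orderEmbOfFin h 1 = A.max' (card_pos.mp (by omega)) :=
  Finset.orderEmbOfFin_last h (by norm_num)

/-- **Log-amplitude of a pair expansion**: `S(X) = ∑_{i<j} U(xᵢ - xⱼ)` (sum over the ordered pairs
`pairsOf univ` of `PeriodicBoseGasJastrow.lean`). [cite: MarchTosi1976, Ch. 8 §8.2 (8.13)] -/
theorem logAmplitude_expansion {N : ℕ} (hU : IsPairPotential L U) (X : Config N) :
    (hU.expansion N).logAmplitude X = ∑ p ∈ pairsOf (univ : Finset (Fin N)), U (X p.1 - X p.2) := by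
  classical
  unfold ManyBodyKernelExpansion.logAmplitude
  -- only the order `k = 2` contributes
  have hvan : ∀ k ∈ Icc 2 N, k ≠ 2 →
      ∑ A ∈ powersetCard k (univ : Finset (Fin N)),
        (hU.expansion N).kernel A.card (subConfig X A) = 0 := by
    intro k _ hk
    refine sum_eq_zero fun A hA => ?_
    rw [expansion_kernel, pairKernelFamily_of_ne_two U ((mem_powersetCard.mp hA).2.trans_ne hk)]
  have ne2 : ∀ {A : Finset (Fin N)}, A ∈ powersetCard 2 (univ : Finset (Fin N)) → A.Nonempty :=
    fun hA => card_pos.mp (by rw [(mem_powersetCard.mp hA).2]; norm_num)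
  have lt2 : ∀ {A : Finset (Fin N)}, A ∈ powersetCard 2 (univ : Finset (Fin N)) → 1 < A.card :=
    fun hA => by rw [(mem_powersetCard.mp hA).2]; norm_num
  by_cases hN : 2 ≤ N
  · rw [sum_eq_single_of_mem 2 (mem_Icc.mpr ⟨le_rfl, hN⟩) hvan]
    -- bijection between 2-subsets and ordered pairs `i < j`
    refine sum_bij' (fun A hA => (A.min' (ne2 hA), A.max' (ne2 hA)))
      (fun p _ => ({p.1, p.2} : Finset (Fin N))) ?_ ?_ ?_ ?_ ?_
    · intro A hA
      exact mem_pairsOf.mpr ⟨mem_univ _, mem_univ _, min'_lt_max'_of_card A (lt2 hA)⟩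
    · intro p hp
      exact mem_powersetCard.mpr ⟨subset_univ _, card_pair (mem_pairsOf.mp hp).2.2.ne⟩
    · intro A hA
      refine eq_of_subset_of_card_le (fun x hx => ?_) ?_
      · simp only [mem_insert, mem_singleton] at hx
        rcases hx with rfl | rfl
        · exact min'_mem _ _
        · exact max'_mem _ _
      · rw [(mem_powersetCard.mp hA).2, card_pair (min'_lt_max'_of_card A (lt2 hA)).ne]
    · intro p hp
      have hlt := (mem_pairsOf.mp hp).2.2
      refine Prod.ext ?_ ?_
      · dsimp only
        rw [min'_insert p.1 {p.2} (singleton_nonempty p.2), min'_singleton, min_eq_left hlt.le]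
      · dsimp only
        rw [max'_insert p.1 {p.2} (singleton_nonempty p.2), max'_singleton, max_eq_right hlt.le]
    · intro A hA
      have h2 : A.card = 2 := (mem_powersetCard.mp hA).2
      rw [apply_card_subConfig (hU.expansion N).kernel X A h2, expansion_kernel, pairKernelFamily_two,
        orderEmbOfFin_two_zero h2, orderEmbOfFin_two_one h2]
  · have h1 : Icc 2 N = ∅ := by
      ext k
      simp only [mem_Icc, Finset.notMem_empty, iff_false]
      omega
    have h2 : pairsOf (univ : Finset (Fin N)) = ∅ := by
      ext p
      simp only [mem_pairsOf, mem_univ, true_and, Finset.notMem_empty, iff_false, not_lt]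
      have := p.1.isLt
      have := p.2.isLt
      rw [Fin.le_def]
      omega
    rw [h1, h2, sum_empty, sum_empty]

/-- The higher kernels of a pair expansion vanish, hence so do their norms. [folklore] -/
@[simp]
theorem kernelNorm_expansion {N : ℕ} (hU : IsPairPotential L U) {m : ℕ} (hm : m ≠ 1) :
    (hU.expansion N).kernelNorm m = 0 := by
  have hk : m + 1 ≠ 2 := by omega
  simp [ManyBodyKernelExpansion.kernelNorm, pairKernelFamily_of_ne_two U hk]

/-- **The polymer norm of a pair (Jastrow) expansion vanishes.** [folklore] -/
@[simp]
theorem polymerNorm_expansion {N : ℕ} (hU : IsPairPotential L U) (w : ℝ) :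
    (hU.expansion N).polymerNorm w = 0 := by
  refine sum_eq_zero fun j hj => ?_
  rw [kernelNorm_expansion hU (by have := (mem_Icc.mp hj).1; omega), mul_zero]

end IsPairPotential

/-- **The core potential of a pair profile.** For a pair profile `φ` with cut-off `b`, `2b ≤ L`, the
periodic pair factor `Φ = φ ∘ reduce L` is even and `Lℤ³`-periodic, so `-log Φ` is a pair potential
(with the junk value `-log 0 = 0` inside a hard core, where the represented state vanishes anyway).
[folklore] -/
theorem IsPairProfile.isPairPotential_negLog {L b : ℝ} {φ : Space → ℝ} (hφ : IsPairProfile b φ)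
    (hL : 0 < L) (hbL : 2 * b ≤ L) : IsPairPotential L fun y => -Real.log (pairFactor L φ y) where
  measurable :=
    (Real.measurable_log.comp (hφ.contDiff.continuous.measurable.comp (measurable_reduce L))).neg
  even y := by rw [hφ.pairFactor_neg hL hbL]
  periodic y j := by rw [single_eq_latticeVec, pairFactor_add_latticeVec hL.ne']

namespace ManyBodyKernelExpansion

variable {N : ℕ} {L : ℝ}

/-- **Core + tail pair kernels** (the pair part of the screening class of route BECGhostPlasma): the pair
kernel of `u` is `u₂(x₁, x₂) = -log Φ(x₁ - x₂) + T(x₁ - x₂)` where `Φ = φ ∘ reduce L` is the periodic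
pair factor of a pair profile `φ` with cut-off `b` (`C¹`, even, `0 ≤ φ ≤ 1`, `φ = 1` off the ball `B_b`,
`2b ≤ L` — a scattering-type core as in LSSY (2.17)–(2.18); such profiles are furnished from the
zero-energy scattering solution by `LSSY2005_dysonProfile` of `PeriodicBoseGasUpperBound.lean`) and `T`
is an even periodic tail of the Reatto–Chester class with constant `C` (the `r⁻²` tail (8.15) of the
Jastrow pseudopotential). Nothing is asked of the kernels of order `≠ 2`.
[cite: MarchTosi1976, Ch. 8 §8.2 (8.13)–(8.15)] -/
structure HasCoreTail (u : ManyBodyKernelExpansion N L) (b C : ℝ) (φ T : Space → ℝ) : Prop where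
  two_mul_le : 2 * b ≤ L
  profile : IsPairProfile b φ
  tail : IsPairPotential L T
  fourier_tail : IsReattoChesterTail L C T
  kernel_two : ∀ Y : Config 2,
    u.kernel 2 Y = -Real.log (pairFactor L φ (Y 0 - Y 1)) + T (Y 0 - Y 1)

/-- With a core + tail pair kernel, the pair kernel of `u` is the pair kernel of the expansion of the
pair potential `-log Φ + T`. [folklore] -/
theorem HasCoreTail.kernel_two_eq {u : ManyBodyKernelExpansion N L} {b C : ℝ} {φ T : Space → ℝ}
    (h : u.HasCoreTail b C φ T) (hL : 0 < L) (Y : Config 2) :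
    u.kernel 2 Y =
      (((h.profile.isPairPotential_negLog hL h.two_mul_le).add h.tail).expansion N).kernel 2 Y := by
  rw [h.kernel_two, IsPairPotential.expansion_kernel, pairKernelFamily_two, Pi.add_apply]

/-- Rescaling a represented function by a non-zero constant keeps it represented (the constant `c`
shifts). [folklore] -/
theorem Represents.of_norm_eq_mul {Ψ Φ : Config N → ℂ} {u : ManyBodyKernelExpansion N L}
    (h : Represents Ψ u) {r : ℝ} (hr : 0 < r) (hΦ : ∀ X, ‖Φ X‖ = ‖Ψ X‖ * r) : Represents Φ u := by
  obtain ⟨c, hc⟩ := h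
  refine ⟨c - Real.log r, fun X hX => ?_⟩
  have hΨ : Ψ X ≠ 0 := by
    intro h0
    apply hX
    rw [← norm_eq_zero, hΦ, h0, norm_zero, zero_mul]
  rw [hΦ, hc X hΨ, ← Real.exp_log hr, ← Real.exp_add, Real.log_exp]
  congr 1
  ring

end ManyBodyKernelExpansion

open ManyBodyKernelExpansion

section Jastrow

variable {N : ℕ} {L b : ℝ} {φ : Space → ℝ}

/-- **The Jastrow case.** The product state `Ψ(X) = ∏_{i<j} Φ(xᵢ - xⱼ)` of `PeriodicBoseGasJastrow.lean`
is represented (with constant `0`) by the expansion of the core potential `-log Φ`: wherever `Ψ(X) ≠ 0`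
all factors are positive and `Ψ = exp(-∑_{i<j} (-log Φ(xᵢ - xⱼ)))`.
[cite: MarchTosi1976, Ch. 8 §8.2 (8.13)] -/
theorem IsPairProfile.represents_jastrowC (hφ : IsPairProfile b φ) (hL : 0 < L) (hbL : 2 * b ≤ L) :
    Represents (jastrowC (N := N) L φ) ((hφ.isPairPotential_negLog hL hbL).expansion N) := by
  refine ⟨0, fun X hX => ?_⟩
  rw [add_zero, IsPairPotential.logAmplitude_expansion]
  have hX' : jastrow L φ univ X ≠ 0 := fun h => hX (by simp [jastrowC, h])
  have hpos : ∀ p ∈ pairsOf (univ : Finset (Fin N)), 0 < pairFactor L φ (X p.1 - X p.2) := by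
    intro p hp
    refine lt_of_le_of_ne (hφ.pairFactor_nonneg _) (Ne.symm fun h0 => hX' ?_)
    exact prod_eq_zero hp h0
  rw [jastrowC, Complex.norm_real, Real.norm_eq_abs, abs_of_nonneg (hφ.jastrow_nonneg univ X),
    sum_neg_distrib, neg_neg, Real.exp_sum]
  exact prod_congr rfl fun p hp => (Real.exp_log (hpos p hp)).symm

/-- The Jastrow expansion is in the core + tail class with zero tail (any `C ≥ 0`). [folklore] -/
theorem IsPairProfile.hasCoreTail_expansion (hφ : IsPairProfile b φ) (hL : 0 < L) (hbL : 2 * b ≤ L)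
    {C : ℝ} (hC : 0 ≤ C) :
    ((hφ.isPairPotential_negLog hL hbL).expansion N).HasCoreTail b C φ 0 where
  two_mul_le := hbL
  profile := hφ
  tail := ⟨measurable_const, fun _ => rfl, fun _ _ => rfl⟩
  fourier_tail := IsReattoChesterTail.zero L hC
  kernel_two Y := by simp

/-- The normalised LSSY trial state `Ψ/‖Ψ‖` (`IsPairProfile.trialState`) is represented by the same
expansion (the normalisation is absorbed in the constant). [cite: LSSY2005, Thm. 2.2, proof, (2.15)–(2.18)] -/
theorem IsPairProfile.represents_trialState (hφ : IsPairProfile b φ) (hL : 0 < L) (hbL : 2 * b < L)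
    (hν : 0 < jastrowNormR L φ (univ : Finset (Fin N))) :
    Represents (hφ.trialState hL hbL hν).ψ ((hφ.isPairPotential_negLog hL hbL.le).expansion N) := by
  refine (hφ.represents_jastrowC hL hbL.le).of_norm_eq_mul
    (r := (Real.sqrt (jastrowNormR L φ (univ : Finset (Fin N))))⁻¹) (by positivity) fun X => ?_
  simp only [IsPairProfile.trialState, jastrowC, Complex.norm_real, norm_mul, norm_inv,
    Real.norm_of_nonneg (Real.sqrt_nonneg _)]

end Jastrow

end Literature.MathematicalPhysics.QuantumManyBody.BoseGas

end
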